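import Summits.CriticalPhenomena.SAWScalingLimit.Theses.SAWFrontierHomotopy
import Summits.CriticalPhenomena.SAWScalingLimit.Theorems.SubseqIdentification.Negative.ReversalLattice
import Summits.CriticalPhenomena.SAWScalingLimit.Theorems.SAWLoopFugacityFlowIsingBoundaryRatioRestrictionMapAtInfty

/-!
# `SwapUniformizer` (line `birth`, crux `OneSidedPowerLaw`, stmt-CriticalPhenomena-10702)

Stub `stub_swapUniformizer` of the line `birth` for the crux
`Summit.CriticalPhenomena.SAWScalingLimit.Theses.SAWFrontierHomotopy.OneSidedPowerLaw`: the
conformal-geometry half of the reversal symmetry of the chordal self-avoiding walk. The inversion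
`ι(z) = -1/z` is a conformal automorphism of the upper half-plane `ℍ` exchanging the boundary
points `0` and `∞`, so for a chordal uniformizer `φ : ℍ → (D; a, b)` (`φ(0) = a`, `φ(∞) = b`) the
composite `φ' = φ ∘ ι` is a chordal uniformizer of the SWAPPED Dobrushin domain
`D.swap = (D; b, a)` (same carrier, marked points exchanged), and for every `D'` the pulled-back
hull `closure (ℍ ∖ φ'⁻¹ D')` is the inverted hull `invHull A = {w | -1/w ∈ A}` of the pulled-back
hull `A = closure (ℍ ∖ φ⁻¹ D')` — provided `A` is a `*`-hull (compact, off `0`), so that `closure`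
commutes with `ι`. This is [LSW 2003, §2 p. 8], `𝒬₋ = σ(𝒬₊)`, made concrete for uniformizers.

Proof: `φ' := invEquivUpperHalfPlane.trans φ`; its boundary values at `0` and `∞` are those of
`φ` at `∞` and `0` (`ι → ∞` within `ℍ` at `0`, `ι → 0` within `ℍ` at `∞`); the set identity
`ℍ ∖ φ'⁻¹ D' = invHull (ℍ ∖ φ⁻¹ D')` is pointwise (`ι` preserves `ℍ` and is an involution); and
`closure (invHull S) = invHull (closure S)` when `closure S` is compact and misses `0` (`ι` is
continuous off `0`: the image of the compact closure is closed, and `ι '' closure S ⊆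
closure (ι '' S)`).
-/

noncomputable section

open scoped Topology
open Filter Set Metric Complex Bornology
open UpperHalfPlane (upperHalfPlaneSet isOpen_upperHalfPlaneSet)
open Literature.Probability.RandomPlanarGeometry Literature.Probability.LatticeModels

namespace Summit.CriticalPhenomena.SAWScalingLimit.Theorems.OneSidedPowerLaw

/-- `-1/w → ∞` within `ℍ` as `w → 0` within `ℍ`. [folklore] -/
theorem tendsto_neg_inv_nhdsWithin_zero_upperHalfPlaneSet :
    Tendsto (fun w : ℂ ↦ -w⁻¹) (𝓝[upperHalfPlaneSet] 0) (cocompact ℂ ⊓ 𝓟 upperHalfPlaneSet) := by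
  have h := Theorems.IsingBoundaryRatio.tendsto_neg_inv_nhdsWithin_zero (∅ : Set ℂ)
  rwa [invHull, preimage_empty, Set.sdiff_empty] at h

/-- `-1/w → 0` within `ℍ` as `w → ∞` within `ℍ`. [folklore] -/
theorem tendsto_neg_inv_cocompact_inf_upperHalfPlaneSet :
    Tendsto (fun w : ℂ ↦ -w⁻¹) (cocompact ℂ ⊓ 𝓟 upperHalfPlaneSet) (𝓝[upperHalfPlaneSet] 0) := by
  have h := tendsto_neg_inv_cocompact_inf (∅ : Set ℂ)
  rwa [invHull, preimage_empty, Set.sdiff_empty] at h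

/-- **Pulled-back complements invert pointwise**: for any `φ : ℂ → ℂ` and `T ⊆ ℂ`,
`ℍ ∖ {z ∈ ℍ | φ (-1/z) ∈ T} = invHull (ℍ ∖ {z ∈ ℍ | φ z ∈ T})` (`ι(z) = -1/z` preserves `ℍ` and
is an involution). [folklore] -/
theorem diff_setOf_negInv_eq_invHull (φ : ℂ → ℂ) (T : Set ℂ) :
    upperHalfPlaneSet \ {z : ℂ | z ∈ upperHalfPlaneSet ∧ φ (-z⁻¹) ∈ T} =
      invHull (upperHalfPlaneSet \ {z : ℂ | z ∈ upperHalfPlaneSet ∧ φ z ∈ T}) := by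
  ext w
  simp only [Set.mem_sdiff, mem_setOf_eq, mem_invHull_iff]
  constructor
  · rintro ⟨hw, hnot⟩
    exact ⟨neg_inv_mem_upperHalfPlaneSet hw, fun h ↦ hnot ⟨hw, h.2⟩⟩
  · rintro ⟨hw', hnot⟩
    have hw : w ∈ upperHalfPlaneSet := by
      have h := neg_inv_mem_upperHalfPlaneSet hw'
      rwa [neg_inv_neg_inv] at h
    exact ⟨hw, fun h ↦ hnot ⟨hw', h.2⟩⟩

/-- **`closure` commutes with inversion on sets whose closure is compact and misses `0`**:
`closure (invHull S) = invHull (closure S)`. Indeed `ι(z) = -1/z` is continuous on `closure S`,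
so `ι '' closure S` is compact, hence closed, and contains `invHull S = ι '' S`; conversely
`ι '' closure S ⊆ closure (ι '' S)`. [folklore] -/
theorem closure_invHull_eq {S : Set ℂ} (hc : IsCompact (closure S)) (h0 : (0 : ℂ) ∉ closure S) :
    closure (invHull S) = invHull (closure S) := by
  have hne : closure S ⊆ {z : ℂ | z ≠ 0} := fun z hz h ↦ h0 (h ▸ hz)
  have hcont : ContinuousOn (fun z : ℂ ↦ -z⁻¹) (closure S) :=
    Theorems.IsingBoundaryRatio.continuousOn_neg_inv hne
  refine Subset.antisymm ?_ ?_
  · refine closure_minimal (invHull_mono subset_closure) ?_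
    rw [invHull_eq_image (closure S)]
    exact (hc.image_of_continuousOn hcont).isClosed
  · rw [invHull_eq_image (closure S), invHull_eq_image S]
    exact hcont.image_closure

/-- **SwapUniformizer** (stub 2 of the line `birth` for `OneSidedPowerLaw`): for every Dobrushin
domain `D`, every `D'`, and every chordal uniformizer `φ` of `D` whose pulled-back hull
`A = closure (ℍ ∖ {z ∈ ℍ | φ z ∈ D'})` is a `*`-hull, the composite `φ ∘ ι` (`ι(z) = -1/z`) is a
chordal uniformizer of the swapped domain `D.swap = (D; b, a)` whose pulled-back hull of `D'` is
EXACTLY the inverted hull `invHull A`. [cite: LawlerSchrammWerner2003Restriction, §2 p. 8 (𝒬₋ = σ(𝒬₊))] -/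
theorem stub_swapUniformizer : ∀ (D D' : DobrushinDomain) (φ : ConformalEquiv upperHalfPlaneSet D.carrier), D.IsChordalUniformizing φ → IsStarHull (closure (upperHalfPlaneSet \ {z : ℂ | z ∈ upperHalfPlaneSet ∧ φ z ∈ D'.carrier})) → ∃ φ' : ConformalEquiv upperHalfPlaneSet D.swap.carrier, D.swap.IsChordalUniformizing φ' ∧ closure (upperHalfPlaneSet \ {z : ℂ | z ∈ upperHalfPlaneSet ∧ φ' z ∈ D'.carrier}) = invHull (closure (upperHalfPlaneSet \ {z : ℂ | z ∈ upperHalfPlaneSet ∧ φ z ∈ D'.carrier})) := by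
  intro D D' φ hφ hA
  refine ⟨invEquivUpperHalfPlane.trans φ, ⟨?_, ?_⟩, ?_⟩
  · -- boundary value at `0`: `φ' z = φ (-1/z) → φ(∞) = b = D.swap.pt 0`
    show Tendsto (invEquivUpperHalfPlane.trans φ) (𝓝[upperHalfPlaneSet] 0) (𝓝 (D.swap.pt 0))
    rw [MarkedDomain.pt_swap_zero]
    refine (hφ.2.comp tendsto_neg_inv_nhdsWithin_zero_upperHalfPlaneSet).congr fun z ↦ ?_
    simp only [Function.comp_apply, ConformalEquiv.trans_apply, invEquivUpperHalfPlane_apply]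
  · -- boundary value at `∞`: `φ' z = φ (-1/z) → φ(0) = a = D.swap.pt 1`
    show Tendsto (invEquivUpperHalfPlane.trans φ) (cocompact ℂ ⊓ 𝓟 upperHalfPlaneSet)
      (𝓝 (D.swap.pt 1))
    rw [MarkedDomain.pt_swap_one]
    refine (hφ.1.comp tendsto_neg_inv_cocompact_inf_upperHalfPlaneSet).congr fun z ↦ ?_
    simp only [Function.comp_apply, ConformalEquiv.trans_apply, invEquivUpperHalfPlane_apply]
  · -- the pulled-back hull of `D'` under `φ ∘ ι` is the inverted pulled-back hull under `φ`
    have hset : upperHalfPlaneSet \ {z : ℂ | z ∈ upperHalfPlaneSet ∧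
        (invEquivUpperHalfPlane.trans φ) z ∈ D'.carrier} =
        invHull (upperHalfPlaneSet \ {z : ℂ | z ∈ upperHalfPlaneSet ∧ φ z ∈ D'.carrier}) := by
      simp only [ConformalEquiv.trans_apply, invEquivUpperHalfPlane_apply]
      exact diff_setOf_negInv_eq_invHull φ D'.carrier
    show closure (upperHalfPlaneSet \ {z : ℂ | z ∈ upperHalfPlaneSet ∧
        (invEquivUpperHalfPlane.trans φ) z ∈ D'.carrier}) =
      invHull (closure (upperHalfPlaneSet \ {z : ℂ | z ∈ upperHalfPlaneSet ∧ φ z ∈ D'.carrier}))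
    rw [hset]
    exact closure_invHull_eq hA.1.isCompact hA.2

end Summit.CriticalPhenomena.SAWScalingLimit.Theorems.OneSidedPowerLaw

end
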